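import Mathlib
import Literature.MathematicalPhysics.QuantumFieldTheory.AbelianTorusCochains
import Literature.Probability.LatticeModels.TorusFourierProofs
import HarnessLib

/-!
# Closed real `2`-cochains on the discrete torus with no torus flux are exact

Stub `stub_torusTwoFormExact` (B1) of line `Sketch` for the crux
`Summit.QuantumFields.YangMills.Theses.ScalingWindowSplit.SelfNormalisedSkewness`
(item stmt-QuantumFields-18944, negation branch via the `U(1)` lattice-gauge witness).

On the discrete torus `(ℤ/S)^d` (the stub is `d = 4`), an alternating real plaquette field `ω` with
vanishing cube flux `td₂ ω = 0` (Bianchi identity) and vanishing total sum `∑ₓ ω(x; μ, ν) = 0` in every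
orientation is a coboundary, `ω = td₁ θ`.  This is the computation `H²((ℤ/S)^d; ℝ) ≅ ℝ^{d(d-1)/2}`,
the classes being detected by the total sums.

Proof (torus Fourier transform `Literature.Probability.LatticeModels.torusFourier`): in the Fourier
variable `k` the coboundaries `td₁`, `td₂` are the Koszul maps of the vector
`K(k) = (χ_k(e_μ) - 1)_μ` (`torusFourier_td₁`, `torusFourier_td₂`); closedness gives the pointwise
identity `|K|² ω̂_{ij} = K_i â_j - K_j â_i`, `â_j = ∑_l conj(K_l) ω̂_{lj}` (`koszul_two_form`), the
normaliser `|K(k)|²` is non-zero for `k ≠ 0` (injectivity of `ZMod.stdAddChar`, `koszulNorm_ne_zero`),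
and `k = 0` is exactly the total-sum condition (`torusFourier_apply_zero`).  Fourier inversion
(`torusFourier_inversion_holds`, `torusFourier_torusFourierInv_holds`) produces a complex primitive,
whose real part is the required real one.  The shift-multiplier computation inside
`torusFourier_fwdDiff` and `torusChar_te` are adapted from
`Summits/QuantumFields/QCD/Theorems/SpectralDefectExtinctionTipNoBindingStubSobolevSup.lean`.
-/

noncomputable section

open Finset
open scoped ComplexConjugate BigOperators

open Literature.MathematicalPhysics.QuantumFieldTheory
open Literature.Probability.LatticeModels (TorusSite torusChar torusFourier torusFourierInv
  torusFourier_eq_sum_torusChar torusChar_add_right torusChar_mul_conj torusChar_zero_left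
  torusFourier_inversion_holds torusFourier_torusFourierInv_holds torusFourier_apply_zero)

namespace Summit.QuantumFields.YangMills.Theorems.SelfNormalisedSkewness.Negative

variable {d L : ℕ}

section Toolkit

variable [NeZero L]

/-- `torusFourier` is additive (pointwise form). [folklore] -/
theorem torusFourier_add_apply (f g : TorusSite d L → ℂ) (k : TorusSite d L) :
    torusFourier (fun x => f x + g x) k = torusFourier f k + torusFourier g k := by
  simp only [torusFourier, add_mul, Finset.sum_add_distrib]

/-- `torusFourier` commutes with subtraction (pointwise form). [folklore] -/
theorem torusFourier_sub_apply (f g : TorusSite d L → ℂ) (k : TorusSite d L) :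
    torusFourier (fun x => f x - g x) k = torusFourier f k - torusFourier g k := by
  simp only [torusFourier, sub_mul, Finset.sum_sub_distrib]

/-- `torusFourier` commutes with negation (pointwise form). [folklore] -/
theorem torusFourier_neg_apply (f : TorusSite d L → ℂ) (k : TorusSite d L) :
    torusFourier (fun x => -f x) k = -torusFourier f k := by
  simp only [torusFourier, neg_mul, Finset.sum_neg_distrib]

/-- `torusFourier` of the zero function vanishes. [folklore] -/
theorem torusFourier_zero_fun (k : TorusSite d L) :
    torusFourier (fun _ => (0 : ℂ)) k = 0 := by
  simp [torusFourier]

/-- **Forward-difference multiplier**: `𝓕(f(· + e) - f)(k) = (χ_k(e) - 1) · 𝓕f(k)` (the translate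
`f(· + e)` has Fourier transform `χ_k(e) · 𝓕f(k)`, by the reindexing `x ↦ x + e`; cf. the landed
`Summit.QuantumFields.QCD.Cruxes.TipNoBinding.PositivityNoLeakSpread.torusFourier_comp_add`). [folklore] -/
theorem torusFourier_fwdDiff (f : TorusSite d L → ℂ) (e k : TorusSite d L) :
    torusFourier (fun x => f (x + e) - f x) k = (torusChar k e - 1) * torusFourier f k := by
  -- the shift multiplier, proof adapted from
  -- Summits/QuantumFields/QCD/Theorems/SpectralDefectExtinctionTipNoBindingStubSobolevSup.lean
  have hshift : torusFourier (fun x => f (x + e)) k = torusChar k e * torusFourier f k := by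
    rw [torusFourier_eq_sum_torusChar, torusFourier_eq_sum_torusChar, Finset.mul_sum]
    refine Fintype.sum_equiv (Equiv.addRight e) _ _ fun x => ?_
    rw [Equiv.coe_addRight, torusChar_add_right, map_mul]
    have h := torusChar_mul_conj k e
    linear_combination (-(f (x + e) * (starRingEnd ℂ) (torusChar k x))) * h
  rw [torusFourier_sub_apply (fun x => f (x + e)) f k, hshift, sub_mul, one_mul]

/-- The character at a unit vector is the one-dimensional standard character:
`χ_k(e_μ) = e(k_μ)`. [folklore] -/
theorem torusChar_te (k : TorusSite d L) (μ : Fin d) :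
    torusChar k (LatticeForm.te μ) = ZMod.stdAddChar (k μ) := by
  -- adapted from Summits/QuantumFields/QCD/Theorems/SpectralDefectExtinctionTipNoBindingStubSobolevSup.lean
  classical
  unfold torusChar
  rw [Finset.prod_eq_single μ]
  · simp
  · intro i _ hi
    simp [Pi.single_eq_of_ne hi]
  · simp

/-- `χ_k(e_μ) = 1` only if `k_μ = 0` (injectivity of `ZMod.stdAddChar`). [folklore] -/
theorem apply_eq_zero_of_torusChar_te_eq_one {k : TorusSite d L} {μ : Fin d}
    (h : torusChar k (LatticeForm.te μ) = 1) : k μ = 0 := by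
  rw [torusChar_te] at h
  have h' : ZMod.stdAddChar (k μ) = ZMod.stdAddChar (0 : ZMod L) := by
    rw [h, AddChar.map_zero_eq_one]
  exact ZMod.injective_stdAddChar h'

/-- **The Koszul normaliser is invertible off the zero mode**: for `k ≠ 0`,
`∑_l conj(χ_k(e_l) - 1) · (χ_k(e_l) - 1) = ∑_l |χ_k(e_l) - 1|² ≠ 0`. [folklore] -/
theorem koszulNorm_ne_zero {k : TorusSite d L} (hk : k ≠ 0) :
    (∑ l, conj (torusChar k (LatticeForm.te l) - 1) * (torusChar k (LatticeForm.te l) - 1)) ≠ 0 := by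
  obtain ⟨l, hl⟩ : ∃ l, k l ≠ 0 := by
    by_contra h
    push Not at h
    exact hk (funext h)
  have hne : torusChar k (LatticeForm.te l) - 1 ≠ 0 := fun h0 =>
    hl (apply_eq_zero_of_torusChar_te_eq_one (sub_eq_zero.1 h0))
  have hreal : ∀ m : Fin d,
      conj (torusChar k (LatticeForm.te m) - 1) * (torusChar k (LatticeForm.te m) - 1) =
        ((Complex.normSq (torusChar k (LatticeForm.te m) - 1) : ℝ) : ℂ) := fun m => by
    rw [mul_comm, Complex.mul_conj]
  simp_rw [hreal]
  rw [← Complex.ofReal_sum, Complex.ofReal_ne_zero]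
  exact ne_of_gt (Finset.sum_pos' (fun m _ => Complex.normSq_nonneg _)
    ⟨l, Finset.mem_univ _, Complex.normSq_pos.2 hne⟩)

/-- **Pointwise Koszul identity.** If `Ω` is alternating and Koszul-closed for the vector `K`
(`K_i Ω_{jl} - K_j Ω_{il} + K_l Ω_{ij} = 0`), then `|K|² Ω_{ij} = K_i a_j - K_j a_i` with
`a_j = ∑_l conj(K_l) Ω_{lj}` (exactness of the Koszul complex off `K = 0`). [folklore] -/
theorem koszul_two_form {K : Fin d → ℂ} {Ω : Fin d → Fin d → ℂ}
    (hΩ : ∀ i j, Ω j i = -Ω i j)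
    (hcl : ∀ i j l, K i * Ω j l - K j * Ω i l + K l * Ω i j = 0) (i j : Fin d) :
    (∑ l, conj (K l) * K l) * Ω i j =
      K i * (∑ l, conj (K l) * Ω l j) - K j * (∑ l, conj (K l) * Ω l i) := by
  rw [Finset.sum_mul, Finset.mul_sum, Finset.mul_sum, ← Finset.sum_sub_distrib]
  refine Finset.sum_congr rfl fun l _ => ?_
  have h := hcl i j l
  rw [hΩ l j, hΩ l i] at h
  linear_combination conj (K l) * h

/-- `torusFourier` is injective (Fourier inversion). [folklore] -/
theorem torusFourier_injective {f g : TorusSite d L → ℂ}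
    (h : ∀ k, torusFourier f k = torusFourier g k) : f = g :=
  calc f = torusFourierInv (torusFourier f) := (torusFourier_inversion_holds (d := d) (L := L) f).symm
    _ = torusFourierInv (torusFourier g) := by rw [show torusFourier f = torusFourier g from funext h]
    _ = g := torusFourier_inversion_holds (d := d) (L := L) g

end Toolkit

section Cochains

variable [NeZero L]

/-- **`td₁` in Fourier variables**: `𝓕(td₁ θ(·; i, j))(k) = K_i θ̂_j - K_j θ̂_i` with
`K_μ = χ_k(e_μ) - 1`. [folklore] -/
theorem torusFourier_td₁ (θ : Site d L → Fin d → ℂ) (i j : Fin d) (k : TorusSite d L) :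
    torusFourier (fun x => LatticeForm.td₁ θ x i j) k =
      (torusChar k (LatticeForm.te i) - 1) * torusFourier (fun x => θ x j) k -
        (torusChar k (LatticeForm.te j) - 1) * torusFourier (fun x => θ x i) k := by
  have e1 : (fun x => LatticeForm.td₁ θ x i j) =
      fun x => (θ (x + LatticeForm.te i) j - θ x j) - (θ (x + LatticeForm.te j) i - θ x i) := by
    funext x; simp only [LatticeForm.td₁]; ring
  rw [e1, torusFourier_sub_apply (fun x => θ (x + LatticeForm.te i) j - θ x j)
      (fun x => θ (x + LatticeForm.te j) i - θ x i),
    torusFourier_fwdDiff (fun x => θ x j), torusFourier_fwdDiff (fun x => θ x i)]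

/-- **`td₂` in Fourier variables**:
`𝓕(td₂ ω(·; i, j, l))(k) = K_i ω̂_{jl} - K_j ω̂_{il} + K_l ω̂_{ij}`. [folklore] -/
theorem torusFourier_td₂ (ω : Site d L → Fin d → Fin d → ℂ) (i j l : Fin d) (k : TorusSite d L) :
    torusFourier (fun x => LatticeForm.td₂ ω x i j l) k =
      (torusChar k (LatticeForm.te i) - 1) * torusFourier (fun x => ω x j l) k -
        (torusChar k (LatticeForm.te j) - 1) * torusFourier (fun x => ω x i l) k +
        (torusChar k (LatticeForm.te l) - 1) * torusFourier (fun x => ω x i j) k := by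
  have e1 : (fun x => LatticeForm.td₂ ω x i j l) =
      fun x => ((ω (x + LatticeForm.te i) j l - ω x j l) - (ω (x + LatticeForm.te j) i l - ω x i l)) +
        (ω (x + LatticeForm.te l) i j - ω x i j) := by
    funext x; simp only [LatticeForm.td₂]
  rw [e1, torusFourier_add_apply
      (fun x => (ω (x + LatticeForm.te i) j l - ω x j l) - (ω (x + LatticeForm.te j) i l - ω x i l))
      (fun x => ω (x + LatticeForm.te l) i j - ω x i j),
    torusFourier_sub_apply (fun x => ω (x + LatticeForm.te i) j l - ω x j l)
      (fun x => ω (x + LatticeForm.te j) i l - ω x i l),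
    torusFourier_fwdDiff (fun x => ω x j l), torusFourier_fwdDiff (fun x => ω x i l),
    torusFourier_fwdDiff (fun x => ω x i j)]

/-- **Closed complex `2`-cochains on the torus with no torus flux are exact.**  If an alternating
complex `2`-cochain `ω` on `(ℤ/L)^d` satisfies `td₂ ω = 0` and `∑ₓ ω(x; i, j) = 0` for all `i, j`,
then `ω = td₁ θ` (torus Fourier transform and the pointwise Koszul identity). [folklore] -/
theorem exists_td₁_eq_of_complex (ω : Site d L → Fin d → Fin d → ℂ)
    (halt : ∀ x i j, ω x j i = -ω x i j) (hclosed : LatticeForm.td₂ ω = 0)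
    (hflux : ∀ i j, ∑ x, ω x i j = 0) :
    ∃ θ : Site d L → Fin d → ℂ, LatticeForm.td₁ θ = ω := by
  -- Koszul data in the Fourier variable `k`
  let K : TorusSite d L → Fin d → ℂ := fun k l => torusChar k (LatticeForm.te l) - 1
  let Ωh : Fin d → Fin d → TorusSite d L → ℂ := fun i j k => torusFourier (fun x => ω x i j) k
  let N : TorusSite d L → ℂ := fun k => ∑ l, conj (K k l) * K k l
  let a : Fin d → TorusSite d L → ℂ := fun j k => ∑ l, conj (K k l) * Ωh l j k
  let θh : Fin d → TorusSite d L → ℂ := fun j k => (N k)⁻¹ * a j k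
  -- the Fourier-side identity `K_i θ̂_j - K_j θ̂_i = ω̂_{ij}`
  have hkey : ∀ k i j, K k i * θh j k - K k j * θh i k = Ωh i j k := by
    intro k i j
    by_cases hk : k = 0
    · have hK0 : ∀ l, K k l = 0 := fun l => by
        show torusChar k (LatticeForm.te l) - 1 = 0
        rw [hk, torusChar_zero_left, sub_self]
      have hΩ0 : Ωh i j k = 0 := by
        show torusFourier (fun x => ω x i j) k = 0
        rw [hk, torusFourier_apply_zero]
        exact hflux i j
      rw [hK0 i, hK0 j, hΩ0]
      ring
    · have hN : N k ≠ 0 := koszulNorm_ne_zero hk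
      have hΩalt : ∀ i j, Ωh j i k = -Ωh i j k := fun i j => by
        have e : (fun x => ω x j i) = fun x => -ω x i j := funext fun x => halt x i j
        show torusFourier (fun x => ω x j i) k = -torusFourier (fun x => ω x i j) k
        rw [e, torusFourier_neg_apply]
      have hΩcl : ∀ i j l, K k i * Ωh j l k - K k j * Ωh i l k + K k l * Ωh i j k = 0 := by
        intro i j l
        have h0 : torusFourier (fun x => LatticeForm.td₂ ω x i j l) k = 0 := by
          simp only [hclosed, Pi.zero_apply]
          exact torusFourier_zero_fun k
        rw [torusFourier_td₂] at h0
        exact h0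
      have hz := koszul_two_form (K := K k) (Ω := fun i j => Ωh i j k) hΩalt hΩcl i j
      calc K k i * θh j k - K k j * θh i k
          = (N k)⁻¹ * (K k i * a j k - K k j * a i k) := by
            show K k i * ((N k)⁻¹ * a j k) - K k j * ((N k)⁻¹ * a i k) = _
            ring
        _ = (N k)⁻¹ * (N k * Ωh i j k) := by
            congr 1
            exact hz.symm
        _ = Ωh i j k := by rw [← mul_assoc, inv_mul_cancel₀ hN, one_mul]
  refine ⟨fun x j => torusFourierInv (θh j) x, ?_⟩
  funext x i j
  -- compare the Fourier transforms in `x` at fixed `(i, j)`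
  have hfun : (fun x => LatticeForm.td₁ (fun (x : Site d L) j => torusFourierInv (θh j) x) x i j) =
      fun x => ω x i j := by
    apply torusFourier_injective
    intro k
    rw [torusFourier_td₁]
    have hj : torusFourier (fun x => torusFourierInv (θh j) x) k = θh j k :=
      congrFun (torusFourier_torusFourierInv_holds (d := d) (L := L) (θh j)) k
    have hi : torusFourier (fun x => torusFourierInv (θh i) x) k = θh i k :=
      congrFun (torusFourier_torusFourierInv_holds (d := d) (L := L) (θh i)) k
    rw [hj, hi]
    exact hkey k i j
  exact congrFun hfun x

end Cochains

/-- **Stub B1 — closed, zero-mean real `2`-cochains on the discrete `4`-torus are exact.**  If an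
alternating real plaquette field `ω` on `(ℤ/S)⁴` has vanishing cube flux (`td₂ ω = 0`, Bianchi) and
vanishing total sum in each orientation (no torus flux), then `ω = td₁ θ` for a real link field `θ`.
(Torus Fourier transform: at momentum `k ≠ 0` the Koszul complex of `K(k) = (χ_k(e_μ) - 1)_μ` is
exact, and `k = 0` is exactly the total-sum condition; real part of the complex primitive.) [folklore] -/
theorem stub_torusTwoFormExact (S : ℕ) [NeZero S] (ω : Site 4 S → Fin 4 → Fin 4 → ℝ) (halt : LatticeForm.IsAlt ω) (hclosed : LatticeForm.td₂ ω = 0) (hflux : ∀ μ ν : Fin 4, ∑ x : Site 4 S, ω x μ ν = 0) : ∃ θ : Site 4 S → Fin 4 → ℝ, LatticeForm.td₁ θ = ω := by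
  obtain ⟨ha, -⟩ := halt
  -- complexify `ω`
  have halt' : ∀ (x : Site 4 S) (i j : Fin 4), ((ω x j i : ℝ) : ℂ) = -((ω x i j : ℝ) : ℂ) :=
    fun x i j => by rw [ha x i j, Complex.ofReal_neg]
  have hclosed' : LatticeForm.td₂ (fun (x : Site 4 S) i j => ((ω x i j : ℝ) : ℂ)) = 0 := by
    funext x i j l
    have h := congrFun (congrFun (congrFun (congrFun hclosed x) i) j) l
    simp only [LatticeForm.td₂, Pi.zero_apply] at h ⊢
    exact_mod_cast h
  have hflux' : ∀ i j : Fin 4, ∑ x : Site 4 S, ((ω x i j : ℝ) : ℂ) = 0 := fun i j => by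
    rw [← Complex.ofReal_sum, hflux i j, Complex.ofReal_zero]
  obtain ⟨θc, hθc⟩ := exists_td₁_eq_of_complex (d := 4) (L := S)
    (fun x i j => ((ω x i j : ℝ) : ℂ)) halt' hclosed' hflux'
  -- the real part of the complex primitive is a real primitive
  refine ⟨fun x i => (θc x i).re, ?_⟩
  funext x i j
  have h := congrArg Complex.re (congrFun (congrFun (congrFun hθc x) i) j)
  simp only [LatticeForm.td₁, Complex.add_re, Complex.sub_re, Complex.ofReal_re] at h ⊢
  exact h

end Summit.QuantumFields.YangMills.Theorems.SelfNormalisedSkewness.Negative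

end
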